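/-
Origin: expansion seat `prover-pub-hodgecm-mc-sinst-1-g10-0`, handover #1246 2026-08-20T22:36Z md5 39266018831f (347 l.; NEW additive leaf, ns HodgeCM.Model.ThetaAdelicSide / ….ThetaDistDatum; structure ThetaDistDatum S hV k (ωA hA Φarch harm hdef Uf toIdele ωf fin_V fin_W smooth), kappa₀, fam/famAt/act_fam/isThetaEquivariant_fam, distForm/apply_distForm, dist (FinSB →ₗ[ℂ] (G → ℂ²))/apply_dist/dist_mem_weightForms, isThetaTranslate_fam, dist_ωf_V, instance smulInvariantMeasure_probHaarRelNormOneQuot, chiFin/coe_chiFin_apply, fam_ωf_W, charInv_eq_smul_translate, thetaLift_fam_ωf_W, dist_ωf_W; NAMES for audit: HodgeCM.Model.ThetaAdelicSide.ThetaDistDatum.dist_ωf_V · HodgeCM.Model.ThetaAdelicSide.ThetaDistDatum.dist_ωf_W · HodgeCM.Model.ThetaAdelicSide.ThetaDistDatum.thetaLift_fam_ωf_W) (`HOME/mc/pub-hodgecm-mc-sinst-1-g10/stage65/HodgeCM/Model/AdelicThetaDistribution.lean`, md5 39266018831f, 347 lines);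
landed by the gen-27 packager (p-g27) in gate run 65 as `HodgeCM/Model/AdelicThetaDistribution.lean` (verbatim).
-/
/-
Copyright (c) 2026 the pub-hodgecm formalisation cell (harness21).  New file, not vendored.
Origin: session prover-pub-hodgecm-mc-sinst-1-g10-0 (unit pub-hodgecm-mc-sinst-1-g10, S-INSTANCE CONSTRUCTOR gen 10; the (J4) input of the
(J-Liu-Θ) junction behind E's row 9 `hΘ`: the theta DISTRIBUTION `Φ_f ↦ θ(Φ_∞(·) ⊗ Φ_f, f)` of a slot, from the product structure of the
slot's Weil representation), 2026-08-20.
Intended final place: `HodgeCM/Model/AdelicThetaDistribution.lean` (NEW additive model-layer leaf; imports sinst-1's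
`HodgeCM.Model.AdelicThetaModuleFin` (#1238), discharge-1's `HodgeCM.Model.Junction.LevelSaturation` and the vendored tree files
`Automorphic/AdelicSchwartzBruhatTensor`, `Automorphic/UnitaryGroupArchSection`; nothing imports it; drop alone).
-/
import Summits.HodgeConjecture.HodgeCM.Model.AdelicThetaModuleFin_2
import Summits.HodgeConjecture.HodgeCM.Model.Junction.LevelSaturation
import Literature.NumberTheory.Automorphic.AdelicSchwartzBruhatTensor
import Literature.NumberTheory.Automorphic.UnitaryGroupArchSection

set_option autoImplicit false

/-!
# The theta distribution of a slot: `Φ_f ↦ θ(Φ_∞(·) ⊗ Φ_f, f)`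

For an adelic side `S : ThetaAdelicSide V c` (regime `hV`) and a slot `k`, a **product Weil datum** `D : S.ThetaDistDatum hV k` records
the `arch ⊗ fin` structure of the slot's pair representation `(S.P k).ω` on `𝒮(𝔸_{L⁺}³) = 𝓢((L⁺ ⊗ ℝ)³) ⊗ 𝒮((𝔸_{L⁺}^∞)³)`
(`piSchwartzBruhatEquiv`), in the currencies of its producers:
* `ωA`, `hA : (S.P k).ω (S.ιinf g, 1) = ωA g ⊗ 1` (`adelicTensorEnd (ωA g) id`) — the `ι₁`-archimedean factor is a pure tensor
  (carch `Model/ArchKTypeOf.archKTypeOf`'s `hA`, VERBATIM type);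
* `Φarch : W^∨ →ₗ 𝓢((L⁺ ⊗ ℝ)³)`, `harm` — the harmonic family of `K_∞`-type `τ₁^∨` (`τ₁ = weightOf x₀` on `Stab(x₀) ≤ U(2,1)`) under `ωA`
  (carch's `harm`, VERBATIM type);
* `hdef` — the compact archimedean factors AWAY from `ι₁` fix `Φarch ℓ ⊗ Φ_f` for EVERY finite `Φ_f` ((c5) at the operator level:
  carch `lineRepOf_k_regime_archToAdelicG` + the definite-place vacuum);
* `Uf`, `toIdele : Uf →* ker N_{L/L⁺}(𝔸)`, `ωf : Representation ℂ (U(V)(𝔸_f) × Uf) 𝒮((𝔸_{L⁺}^∞)³)` with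
  `fin_V : (S.P k).ω (finToG k_f, 1) = 1 ⊗ ωf (k_f, 1)` and `fin_W : (S.P k).ω (1, toIdele u) = 1 ⊗ ωf (1, u)` — the finite factor of the
  slot's representation, scalar see-saw characters INCLUDED (theta-3's chain (0): `lineRepD k = lineRepOf k` → carch
  `lineRepOf_k_regime_finAdelicG` → tree `cmLineRepFin_k_apply_eq_smul_cmPairRep` → #S14r2 `pairRep_finPairToAdelic_piSBReindex_tmul`;
  torus slot: carch #CA60 `lineRepOf_k_one_finLineTorus`, `finLineTorusIdeles`);
* `smooth` — every `Φ_f` is fixed under `ωf (·, 1)` by an OPEN subgroup of `U(V)(𝔸_f)` (tree `FiniteWeilLevelFixing` +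
  `exists_eq_sum_smul_finTranslateSB_indicatorSB`).
From `D` this file CONSTRUCTS (kernel, no further input):
* `D.fam Φf : W^∨ →ₗ 𝒮(𝔸³)`, `ℓ ↦ Φarch ℓ ⊗ Φf`, theta-equivariant through `Stab(x₀)` (`isThetaEquivariant_fam`, from `hA` + `harm`);
* **`D.dist f : 𝒮((𝔸_{L⁺}^∞)³) →ₗ[ℂ] (G_U(𝔸) → ℂ²)`** — `Φ_f ↦` the weight-`τ₁` theta form `θ(Φ_∞(·) ⊗ Φ_f, f)` as a function on `G_U(𝔸)`
  (tree `ThetaKernelDatum.thetaForm`), LINEAR in `Φ_f`; `apply_dist` (`ℓ (dist f Φf g) = Θ̃_{Φarch ℓ ⊗ Φf}(f)(g)`);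
* **`dist_ωf_V`**: `dist f (ωf (k_f, 1) Φf) = R_{finToG k_f} (dist f Φf)` — `U(V)(𝔸_f)`-EQUIVARIANCE (tree `rightTranslate_thetaForm` + `fin_V`);
* **`dist_ωf_W`**: `dist (charInv χ) (ωf (1, u) Φf) = χ(toIdele u)⁻¹ • dist (charInv χ) Φf` — `U(W)`-`χ`-VARIANCE (tree
  `thetaLift_act_right`, Haar invariance on `[U(W)]`, + `fin_W`); `D.chiFin χ : Uf →* ℂˣ` names the character.
The saturated/hol-germ packaging into `S.holSatU` and the block membership are the sequel files
`AdelicThetaDistributionSat` / `AdelicThetaDistributionBlock`.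
KERNEL only: one DATA structure (fields = data + equations, like `ProductKTypeData`), 0 `def … : Prop`, nothing cited as a sentence;
`#print axioms` ⊆ {propext, Classical.choice, Quot.sound}.
-/

noncomputable section

open MeasureTheory MulAction IsDedekindDomain NumberField.mixedEmbedding
open NumberField hiding relNormOneIdeles relNormOneRat probHaarRelNormOneQuot
open Literature.NumberTheory.Automorphic Literature.NumberTheory.Weil1964
open Literature.Geometry.ComplexHyperbolic.BallModel (U21 x₀)
open Literature.AlgebraicGeometry.HodgeTheory Literature.AlgebraicGeometry.ShimuraVarieties
open Literature.NumberTheory.Automorphic.PicardCM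
open HodgeCM.Model.SupplyInstance HodgeCM.Model.SupplyResidual HodgeCM.Model.ThetaSpace
open HodgeCM.Model.SupplyResidual.WeilPairData (charInv)
open scoped SchwartzMap TensorProduct Classical

namespace HodgeCM
namespace Model
namespace ThetaAdelicSide

variable {L : CMField} {ι₁ : L →+* ℂ} {V : HermSpace3 L ι₁} {c : SeesawCtx L}

/-! ### § 0. The product Weil datum of a slot -/

/-- **Product Weil datum of the slot `k`** of the adelic side `S` (regime `hV`): the `ι₁`-archimedean factor `ωA` with the harmonic
family `Φarch` of type `τ₁^∨`, the away-from-`ι₁` archimedean fixing of `Φarch ℓ ⊗ Φ_f`, and the finite factor `ωf` of `(S.P k).ω` on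
`𝒮((𝔸_{L⁺}^∞)³)` (pair group `U(V)(𝔸_f) × Uf`, `Uf` the finite torus read into `ker N_{L/L⁺}(𝔸)` by `toIdele`), with smoothness.  DATA. -/
structure ThetaDistDatum (S : ThetaAdelicSide V c) (hV : IsAnisotropic L V.Hm) (k : Fin 4) : Type 1 where
  /-- the `ι₁`-archimedean factor of the slot's Weil representation, as a representation of `U(2,1)` -/
  ωA : Representation ℂ U21 𝓢((Fin 3 → mixedSpace (↥(maximalRealSubfield L))), ℂ)
  /-- (W-⊗) the archimedean component acts by the pure tensor `ωA g ⊗ 1` -/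
  hA : ∀ g : U21, (S.P k).ω (S.ιinf g, 1) =
    adelicTensorEnd (K := ↥(maximalRealSubfield L)) (ι := Fin 3) (ωA g) LinearMap.id
  /-- the harmonic archimedean family `ℓ ↦ Φ_∞(ℓ)` -/
  Φarch : Module.Dual ℂ (Fin 2 → ℂ) →ₗ[ℂ] 𝓢((Fin 3 → mixedSpace (↥(maximalRealSubfield L))), ℂ)
  /-- (W-K∞′) the family is `Stab(x₀)`-equivariant of type `τ₁^∨` under `ωA` -/
  harm : ∀ (u : ↥(stabilizer U21 x₀)) (ℓ : Module.Dual ℂ (Fin 2 → ℂ)),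
    ωA (u : U21) (Φarch ℓ) = Φarch ((BallForms.isPullbackCocycle_cotangentCocycle.weightOf x₀).dual u ℓ)
  /-- (c5, operator form) the compact archimedean factors away from `ι₁` fix `Φarch ℓ ⊗ Φ_f` for every `Φ_f` -/
  hdef : ∀ a : UnitaryGroup.arch (↥(maximalRealSubfield L)) L (IsCMField.complexConj L) 3 V.Hm,
    UnitaryGroup.archAt (↥(maximalRealSubfield L)) L (IsCMField.complexConj L) 3 V.Hm (UnitaryGroup.cmPlace (L : Type) ι₁)
        (NumberField.complexConj_smul_infinitePlace (L : Type) _) (IsCMField.complexConj_ne_one (L : Type)) a = 1 →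
    ∀ (ℓ : Module.Dual ℂ (Fin 2 → ℂ)) (Φf : FinSB (↥(maximalRealSubfield L)) (Fin 3)),
      (S.P k).ω (HodgeCM.Adelic.regimeEquiv L V.Hm hV
          (UnitaryGroup.archToAdelic (↥(maximalRealSubfield L)) L (IsCMField.complexConj L) 3 V.Hm a), 1)
        (piSchwartzBruhatEquiv (↥(maximalRealSubfield L)) (Fin 3) (Φarch ℓ ⊗ₜ[ℂ] Φf)) =
      piSchwartzBruhatEquiv (↥(maximalRealSubfield L)) (Fin 3) (Φarch ℓ ⊗ₜ[ℂ] Φf)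
  /-- the finite torus `U(W_k)(𝔸_f)` -/
  Uf : Type
  [instUf : Group Uf]
  /-- … read into `ker N_{L/L⁺}(𝔸)` (archimedean component `1`) -/
  toIdele : Uf →* ↥(relNormOneIdeles (↥(maximalRealSubfield L)) L)
  /-- the finite factor of the slot's Weil representation (scalar see-saw characters included) -/
  ωf : Representation ℂ (↥V.adelicFin × Uf) (FinSB (↥(maximalRealSubfield L)) (Fin 3))
  /-- (⊗-fin-V) the finite-adelic `U(V)` acts by `1 ⊗ ωf (k_f, 1)` -/
  fin_V : ∀ g : V.adelicFin, (S.P k).ω (finToG V hV g, 1) =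
    adelicTensorEnd (K := ↥(maximalRealSubfield L)) (ι := Fin 3) LinearMap.id (ωf (g, 1))
  /-- (⊗-fin-W) the finite torus acts by `1 ⊗ ωf (1, u)` -/
  fin_W : ∀ u : Uf, (S.P k).ω (1, toIdele u) =
    adelicTensorEnd (K := ↥(maximalRealSubfield L)) (ι := Fin 3) LinearMap.id (ωf (1, u))
  /-- smoothness: every finite test function is fixed by an open subgroup of `U(V)(𝔸_f)` -/
  smooth : ∀ Φf : FinSB (↥(maximalRealSubfield L)) (Fin 3), ∃ K : Subgroup ↥V.adelicFin,
    IsOpen (K : Set ↥V.adelicFin) ∧ ∀ g ∈ K, ωf (g, 1) Φf = Φf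

attribute [instance] ThetaDistDatum.instUf

/-- The archimedean weight group `Stab(x₀) ≤ U(2,1)` mapped into `G_U(𝔸)` along `S.ιinf`. -/
def kappa₀ (S : ThetaAdelicSide V c) : ↥(stabilizer U21 x₀) →* (V.latticeModel printFact_unitaryCompact_holds).G :=
  S.ιinf.comp (stabilizer U21 x₀).subtype

/-- (Ported verbatim from the HodgeCMPerL package; no docstring in the source.) -/
@[simp] theorem kappa₀_apply (S : ThetaAdelicSide V c) (u : ↥(stabilizer U21 x₀)) : kappa₀ S u = S.ιinf u := rfl

namespace ThetaDistDatum

variable {S : ThetaAdelicSide V c} {hV : IsAnisotropic L V.Hm} {k : Fin 4} (D : S.ThetaDistDatum hV k)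

/-! ### § 1. The product test families and the distribution -/

/-- `(ℓ, Φ_f) ↦ Φarch ℓ ⊗ Φ_f ∈ 𝒮(𝔸³)`, bilinear. -/
def fam₂ : Module.Dual ℂ (Fin 2 → ℂ) →ₗ[ℂ] FinSB (↥(maximalRealSubfield L)) (Fin 3) →ₗ[ℂ]
    ↥(piSchwartzBruhat (↥(maximalRealSubfield L)) (Fin 3)) :=
  ((TensorProduct.mk ℂ 𝓢((Fin 3 → mixedSpace (↥(maximalRealSubfield L))), ℂ) (FinSB (↥(maximalRealSubfield L)) (Fin 3))).compr₂
      (piSchwartzBruhatEquiv (↥(maximalRealSubfield L)) (Fin 3)).toLinearMap) ∘ₗ D.Φarch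

/-- (Ported verbatim from the HodgeCMPerL package; no docstring in the source.) -/
@[simp] theorem fam₂_apply (ℓ : Module.Dual ℂ (Fin 2 → ℂ)) (Φf : FinSB (↥(maximalRealSubfield L)) (Fin 3)) :
    D.fam₂ ℓ Φf = piSchwartzBruhatEquiv (↥(maximalRealSubfield L)) (Fin 3) (D.Φarch ℓ ⊗ₜ[ℂ] Φf) := rfl

/-- **The product test family of `Φ_f`**: `ℓ ↦ Φarch ℓ ⊗ Φ_f`, read on the `Θ`-initial carrier of the slot. -/
def fam (Φf : FinSB (↥(maximalRealSubfield L)) (Fin 3)) : Module.Dual ℂ (Fin 2 → ℂ) →ₗ[ℂ] (S.P k).weilDatum.ThetaTop :=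
  D.fam₂.flip Φf

/-- (Ported verbatim from the HodgeCMPerL package; no docstring in the source.) -/
theorem fam_apply (Φf : FinSB (↥(maximalRealSubfield L)) (Fin 3)) (ℓ : Module.Dual ℂ (Fin 2 → ℂ)) :
    D.fam Φf ℓ = (S.P k).weilDatum.toThetaTop
      (piSchwartzBruhatEquiv (↥(maximalRealSubfield L)) (Fin 3) (D.Φarch ℓ ⊗ₜ[ℂ] Φf)) := rfl

/-- The family at a fixed covector, LINEAR in `Φ_f` (read on the `Θ`-initial carrier). -/
def famAt (ℓ : Module.Dual ℂ (Fin 2 → ℂ)) : FinSB (↥(maximalRealSubfield L)) (Fin 3) →ₗ[ℂ] (S.P k).weilDatum.ThetaTop :=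
  D.fam₂ ℓ

/-- (Ported verbatim from the HodgeCMPerL package; no docstring in the source.) -/
theorem famAt_apply (ℓ : Module.Dual ℂ (Fin 2 → ℂ)) (Φf : FinSB (↥(maximalRealSubfield L)) (Fin 3)) :
    D.famAt ℓ Φf = D.fam Φf ℓ := rfl

/-- (W-⊗) + (W-K∞′) ⇒ every product family intertwines `τ₁^∨` with the Weil ACTION `s(ιinf u, 1)` ON THE NOSE. -/
theorem act_fam (Φf : FinSB (↥(maximalRealSubfield L)) (Fin 3)) (u : ↥(stabilizer U21 x₀)) (ℓ : Module.Dual ℂ (Fin 2 → ℂ)) :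
    D.fam Φf ((BallForms.isPullbackCocycle_cotangentCocycle.weightOf x₀).dual u ℓ) =
      (S.P k).kernelDatum.W.act ((S.P k).kernelDatum.s (kappa₀ S u, 1)) (D.fam Φf ℓ) := by
  change piSchwartzBruhatEquiv (↥(maximalRealSubfield L)) (Fin 3) (D.Φarch (_ ) ⊗ₜ[ℂ] Φf) =
    (S.P k).ω (S.ιinf u, 1) (piSchwartzBruhatEquiv (↥(maximalRealSubfield L)) (Fin 3) (D.Φarch ℓ ⊗ₜ[ℂ] Φf))
  rw [D.hA, adelicTensorEnd_apply_tmul, LinearMap.id_apply, D.harm]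

/-- Theta-equivariance of the product family of `Φ_f` through `Stab(x₀)`. -/
theorem isThetaEquivariant_fam (Φf : FinSB (↥(maximalRealSubfield L)) (Fin 3)) :
    (S.P k).kernelDatum.IsThetaEquivariant (kappa₀ S) (BallForms.isPullbackCocycle_cotangentCocycle.weightOf x₀).dual
      (D.fam Φf) :=
  (S.P k).kernelDatum.isThetaEquivariant_of_act fun u ℓ => D.act_fam Φf u ℓ

/-- (Ported verbatim from the HodgeCMPerL package; no docstring in the source.) -/
theorem id_dual_apply (u : ↥(stabilizer U21 x₀)) (ℓ : Module.Dual ℂ (Fin 2 → ℂ)) :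
    (LinearMap.id : Module.Dual ℂ (Fin 2 → ℂ) →ₗ[ℂ] Module.Dual ℂ (Fin 2 → ℂ))
        ((BallForms.isPullbackCocycle_cotangentCocycle.weightOf x₀).dual u ℓ) =
      (BallForms.isPullbackCocycle_cotangentCocycle.weightOf x₀).dual u
        ((LinearMap.id : Module.Dual ℂ (Fin 2 → ℂ) →ₗ[ℂ] Module.Dual ℂ (Fin 2 → ℂ)) ℓ) := rfl

/-- **The weight-`τ₁` theta form of the product family of `Φ_f` against the weight function `f`.** -/
def distForm (f : C(↥(relNormOneIdeles (↥(maximalRealSubfield L)) L) ⧸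
      relNormOneRat (↥(maximalRealSubfield L)) L, ℂ))
    (Φf : FinSB (↥(maximalRealSubfield L)) (Fin 3)) :
    weightForms (S.P k).ΓU (kappa₀ S) (BallForms.isPullbackCocycle_cotangentCocycle.weightOf x₀) :=
  (S.P k).kernelDatum.thetaForm (probHaarRelNormOneQuot (↥(maximalRealSubfield L)) L) (S.P k).kernelDatum_thetaLinear
    (kappa₀ S) (D.fam Φf) (D.isThetaEquivariant_fam Φf) LinearMap.id id_dual_apply f

/-- Defining property: `ℓ (θ g) = Θ̃_{Φarch ℓ ⊗ Φf}(f)(g)`. -/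
theorem apply_distForm (f : C(↥(relNormOneIdeles (↥(maximalRealSubfield L)) L) ⧸
      relNormOneRat (↥(maximalRealSubfield L)) L, ℂ))
    (Φf : FinSB (↥(maximalRealSubfield L)) (Fin 3)) (g : (V.latticeModel printFact_unitaryCompact_holds).G)
    (ℓ : Module.Dual ℂ (Fin 2 → ℂ)) :
    ℓ ((D.distForm f Φf : (V.latticeModel printFact_unitaryCompact_holds).G → (Fin 2 → ℂ)) g) =
      (S.P k).kernelDatum.thetaLiftFun (probHaarRelNormOneQuot (↥(maximalRealSubfield L)) L) (D.fam Φf ℓ) f g :=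
  (S.P k).kernelDatum.apply_thetaForm _ _ _ _ _ _ _ f g ℓ

/-- The same through the `Φ_f`-linear family: `ℓ (θ g) = (Θ̃_·(f) ∘ famAt ℓ) Φf g`. -/
theorem apply_distForm_eq_famAt (f : C(↥(relNormOneIdeles (↥(maximalRealSubfield L)) L) ⧸
      relNormOneRat (↥(maximalRealSubfield L)) L, ℂ))
    (Φf : FinSB (↥(maximalRealSubfield L)) (Fin 3)) (g : (V.latticeModel printFact_unitaryCompact_holds).G)
    (ℓ : Module.Dual ℂ (Fin 2 → ℂ)) :
    ℓ ((D.distForm f Φf : (V.latticeModel printFact_unitaryCompact_holds).G → (Fin 2 → ℂ)) g) =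
      ((S.P k).kernelDatum.thetaLiftFunₗ (probHaarRelNormOneQuot (↥(maximalRealSubfield L)) L) (S.P k).kernelDatum_thetaLinear f
        ∘ₗ D.famAt ℓ) Φf g := by
  rw [apply_distForm, LinearMap.comp_apply, ThetaKernelDatum.thetaLiftFunₗ_apply]
  rfl

/-- **The theta distribution of the slot against the weight function `f`**: `Φ_f ↦ θ(Φ_∞(·) ⊗ Φ_f, f)` as a function
`G_U(𝔸) → ℂ²`, `ℂ`-LINEAR in `Φ_f`. -/
def dist (f : C(↥(relNormOneIdeles (↥(maximalRealSubfield L)) L) ⧸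
      relNormOneRat (↥(maximalRealSubfield L)) L, ℂ)) :
    FinSB (↥(maximalRealSubfield L)) (Fin 3) →ₗ[ℂ] ((V.latticeModel printFact_unitaryCompact_holds).G → (Fin 2 → ℂ)) where
  toFun Φf := (D.distForm f Φf : (V.latticeModel printFact_unitaryCompact_holds).G → (Fin 2 → ℂ))
  map_add' Φf Φf' := by
    funext g
    refine WeightForms.eq_of_forall_dual_eq (R := ℂ) fun ℓ => ?_
    rw [Pi.add_apply, map_add, apply_distForm_eq_famAt, apply_distForm_eq_famAt, apply_distForm_eq_famAt, map_add,
      Pi.add_apply]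
  map_smul' r Φf := by
    funext g
    refine WeightForms.eq_of_forall_dual_eq (R := ℂ) fun ℓ => ?_
    rw [RingHom.id_apply, Pi.smul_apply, map_smul, apply_distForm_eq_famAt, apply_distForm_eq_famAt, map_smul,
      Pi.smul_apply]

/-- (Ported verbatim from the HodgeCMPerL package; no docstring in the source.) -/
theorem dist_apply (f : C(↥(relNormOneIdeles (↥(maximalRealSubfield L)) L) ⧸
      relNormOneRat (↥(maximalRealSubfield L)) L, ℂ)) (Φf : FinSB (↥(maximalRealSubfield L)) (Fin 3)) :
    D.dist f Φf = (D.distForm f Φf : (V.latticeModel printFact_unitaryCompact_holds).G → (Fin 2 → ℂ)) := rfl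

/-- `ℓ (dist f Φf g) = Θ̃_{Φarch ℓ ⊗ Φf}(f)(g)`. -/
theorem apply_dist (f : C(↥(relNormOneIdeles (↥(maximalRealSubfield L)) L) ⧸
      relNormOneRat (↥(maximalRealSubfield L)) L, ℂ)) (Φf : FinSB (↥(maximalRealSubfield L)) (Fin 3))
    (g : (V.latticeModel printFact_unitaryCompact_holds).G) (ℓ : Module.Dual ℂ (Fin 2 → ℂ)) :
    ℓ (D.dist f Φf g) =
      (S.P k).kernelDatum.thetaLiftFun (probHaarRelNormOneQuot (↥(maximalRealSubfield L)) L) (D.fam Φf ℓ) f g :=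
  D.apply_distForm f Φf g ℓ

/-- The distribution takes values in the weight-`τ₁` forms on `Γ_U \ G_U(𝔸)` (weight group `Stab(x₀)` along `S.ιinf`). -/
theorem dist_mem_weightForms (f : C(↥(relNormOneIdeles (↥(maximalRealSubfield L)) L) ⧸
      relNormOneRat (↥(maximalRealSubfield L)) L, ℂ)) (Φf : FinSB (↥(maximalRealSubfield L)) (Fin 3)) :
    D.dist f Φf ∈ weightForms (S.P k).ΓU (kappa₀ S) (BallForms.isPullbackCocycle_cotangentCocycle.weightOf x₀) :=
  (D.distForm f Φf).2


/-! ### § 2. Equivariance under the finite factor -/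

/-- The product family of `ωf (k_f, 1) Φ_f` is the `finToG k_f`-TRANSLATE of that of `Φ_f` ((⊗-fin-V)). -/
theorem isThetaTranslate_fam (g : V.adelicFin) (Φf : FinSB (↥(maximalRealSubfield L)) (Fin 3)) :
    (S.P k).kernelDatum.IsThetaTranslate (finToG V hV g) (D.fam Φf) (D.fam (D.ωf (g, 1) Φf)) :=
  (S.P k).kernelDatum.isThetaTranslate_of_act fun ℓ => by
    change piSchwartzBruhatEquiv (↥(maximalRealSubfield L)) (Fin 3) (D.Φarch ℓ ⊗ₜ[ℂ] D.ωf (g, 1) Φf) =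
      (S.P k).ω (finToG V hV g, 1) (piSchwartzBruhatEquiv (↥(maximalRealSubfield L)) (Fin 3) (D.Φarch ℓ ⊗ₜ[ℂ] Φf))
    rw [D.fin_V, adelicTensorEnd_apply_tmul, LinearMap.id_apply]

/-- **`U(V)(𝔸_f)`-EQUIVARIANCE of the distribution**: `dist f (ωf (k_f, 1) Φ_f) = R_{finToG k_f} (dist f Φ_f)` — translates of theta
forms are theta forms (tree `rightTranslate_thetaForm`) and (⊗-fin-V). -/
theorem dist_ωf_V (f : C(↥(relNormOneIdeles (↥(maximalRealSubfield L)) L) ⧸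
      relNormOneRat (↥(maximalRealSubfield L)) L, ℂ)) (g : V.adelicFin) (Φf : FinSB (↥(maximalRealSubfield L)) (Fin 3)) :
    D.dist f (D.ωf (g, 1) Φf) = ThetaSpace.rightShift (finToG V hV g) (D.dist f Φf) := by
  have h := (S.P k).kernelDatum.rightTranslate_thetaForm
    (probHaarRelNormOneQuot (↥(maximalRealSubfield L)) L) (S.P k).kernelDatum_thetaLinear
    LinearMap.id id_dual_apply (κ := kappa₀ S) (h := finToG V hV g) (fun u => S.commute_finToG_ιinf hV g (u : U21))
    (D.isThetaEquivariant_fam Φf) (D.isThetaTranslate_fam g Φf) f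
  have h2 : D.distForm f (D.ωf (g, 1) Φf) =
      ThetaKernelDatum.rightTranslate (kappa₀ S) (finToG V hV g) (fun u => S.commute_finToG_ιinf hV g (u : U21))
        (D.distForm f Φf) := by
    unfold distForm
    rw [h]
  rw [dist_apply, dist_apply, h2]
  rfl

/-! ### § 3. The finite torus acts through a character on `dist (charInv χ)` -/

section Torus

variable {K' L' : Type} [Field K'] [NumberField K'] [Field L'] [NumberField L'] [Algebra K' L']

/-- The Haar probability measure of `[U(W)] = ker N(𝔸) / ker N(L⁺)` is invariant under the TRANSLATION ACTION of `ker N(𝔸)` on the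
quotient (it is left-invariant on the quotient group; the action is left multiplication by the image). -/
instance smulInvariantMeasure_probHaarRelNormOneQuot :
    SMulInvariantMeasure (↥(relNormOneIdeles K' L'))
      (↥(relNormOneIdeles K' L') ⧸ relNormOneRat K' L')
      (probHaarRelNormOneQuot K' L') := by
  refine ⟨fun t s _ => ?_⟩
  have hfun : (fun q : ↥(relNormOneIdeles K' L') ⧸ relNormOneRat K' L' => t • q) =
      fun q => (QuotientGroup.mk t : ↥(relNormOneIdeles K' L') ⧸ relNormOneRat K' L') * q := by
    funext q
    induction q using QuotientGroup.induction_on with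
    | H y => rw [MulAction.Quotient.smul_mk, smul_eq_mul, QuotientGroup.mk_mul]
  rw [hfun, measure_preimage_mul]

end Torus

/-- **The character of the finite torus on the `χ`-component**: `u ↦ χ(toIdele u)⁻¹ ∈ ℂˣ`. -/
def chiFin (χ : PontryaginDual (↥(relNormOneIdeles (↥(maximalRealSubfield L)) L) ⧸
      relNormOneRat (↥(maximalRealSubfield L)) L)) : D.Uf →* ℂˣ :=
  (Circle.toUnits : Circle →* ℂˣ).comp <| (invMonoidHom : Circle →* Circle).comp <|
    (χ : ↥(relNormOneIdeles (↥(maximalRealSubfield L)) L) ⧸ relNormOneRat (↥(maximalRealSubfield L)) L →*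
        Circle).comp <|
      (QuotientGroup.mk' (relNormOneRat (↥(maximalRealSubfield L)) L)).comp D.toIdele

/-- (Ported verbatim from the HodgeCMPerL package; no docstring in the source.) -/
theorem coe_chiFin_apply (χ : PontryaginDual (↥(relNormOneIdeles (↥(maximalRealSubfield L)) L) ⧸
      relNormOneRat (↥(maximalRealSubfield L)) L)) (u : D.Uf) :
    ((D.chiFin χ u : ℂˣ) : ℂ) = (((χ (QuotientGroup.mk (D.toIdele u)))⁻¹ : Circle) : ℂ) := rfl

/-- The product family of `ωf (1, u) Φ_f` is `s(1, toIdele u)` applied to that of `Φ_f` ((⊗-fin-W)). -/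
theorem fam_ωf_W (u : D.Uf) (Φf : FinSB (↥(maximalRealSubfield L)) (Fin 3)) (ℓ : Module.Dual ℂ (Fin 2 → ℂ)) :
    D.fam (D.ωf (1, u) Φf) ℓ = (S.P k).kernelDatum.W.act ((S.P k).kernelDatum.s (1, D.toIdele u)) (D.fam Φf ℓ) := by
  change piSchwartzBruhatEquiv (↥(maximalRealSubfield L)) (Fin 3) (D.Φarch ℓ ⊗ₜ[ℂ] D.ωf (1, u) Φf) =
    (S.P k).ω (1, D.toIdele u) (piSchwartzBruhatEquiv (↥(maximalRealSubfield L)) (Fin 3) (D.Φarch ℓ ⊗ₜ[ℂ] Φf))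
  rw [D.fin_W, adelicTensorEnd_apply_tmul, LinearMap.id_apply]

/-- `charInv χ` is a `χ⁻¹`-eigenfunction of the translations: `charInv χ (q) = χ(t)⁻¹ · charInv χ (t⁻¹ • q)`. -/
theorem charInv_eq_smul_translate (χ : PontryaginDual (↥(relNormOneIdeles (↥(maximalRealSubfield L)) L) ⧸
      relNormOneRat (↥(maximalRealSubfield L)) L)) (t : ↥(relNormOneIdeles (↥(maximalRealSubfield L)) L))
    (q : ↥(relNormOneIdeles (↥(maximalRealSubfield L)) L) ⧸ relNormOneRat (↥(maximalRealSubfield L)) L) :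
    charInv χ q = ((((χ (QuotientGroup.mk t))⁻¹ : Circle) : ℂ) • charInv χ) (t⁻¹ • q) := by
  induction q using QuotientGroup.induction_on with
  | H y =>
    have harg : ((QuotientGroup.mk y : ↥(relNormOneIdeles (↥(maximalRealSubfield L)) L) ⧸
        relNormOneRat (↥(maximalRealSubfield L)) L))⁻¹ =
        (QuotientGroup.mk t : _ ⧸ relNormOneRat (↥(maximalRealSubfield L)) L)⁻¹ *
          (QuotientGroup.mk (t⁻¹ * y) : _ ⧸ relNormOneRat (↥(maximalRealSubfield L)) L)⁻¹ := by
      rw [← QuotientGroup.mk_inv, ← QuotientGroup.mk_inv, ← QuotientGroup.mk_inv, ← QuotientGroup.mk_mul, mul_inv_rev,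
        inv_inv, ← mul_assoc, inv_mul_cancel_comm]
    rw [MulAction.Quotient.smul_mk, smul_eq_mul, ContinuousMap.smul_apply, smul_eq_mul, WeilPairData.charInv_apply,
      WeilPairData.charInv_apply, ← Circle.coe_mul, ← map_inv, ← map_mul, ← harg]

/-- **The finite torus acts through `chiFin χ` on the `χ`-component of the distribution** (scalar lifts): for every `ξ ∈ Γ_U \ G_U(𝔸)`,
`Θ_{Φarch ℓ ⊗ ωf(1,u)Φf}(charInv χ)(ξ) = χ(toIdele u)⁻¹ · Θ_{Φarch ℓ ⊗ Φf}(charInv χ)(ξ)` (tree `thetaLift_act_right`: translation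
invariance of the Haar measure of `[U(W)]`). -/
theorem thetaLift_fam_ωf_W (χ : PontryaginDual (↥(relNormOneIdeles (↥(maximalRealSubfield L)) L) ⧸
      relNormOneRat (↥(maximalRealSubfield L)) L)) (u : D.Uf) (Φf : FinSB (↥(maximalRealSubfield L)) (Fin 3))
    (ℓ : Module.Dual ℂ (Fin 2 → ℂ)) (ξ : (V.latticeModel printFact_unitaryCompact_holds).G ⧸ (S.P k).ΓU) :
    (S.P k).kernelDatum.thetaLift (probHaarRelNormOneQuot (↥(maximalRealSubfield L)) L)
        (D.fam (D.ωf (1, u) Φf) ℓ) (charInv χ) ξ =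
      ((D.chiFin χ u : ℂˣ) : ℂ) *
        (S.P k).kernelDatum.thetaLift (probHaarRelNormOneQuot (↥(maximalRealSubfield L)) L)
          (D.fam Φf ℓ) (charInv χ) ξ := by
  rw [D.fam_ωf_W, (S.P k).kernelDatum.thetaLift_act_right
      (probHaarRelNormOneQuot (↥(maximalRealSubfield L)) L) (D.fam Φf ℓ) (D.toIdele u)
      (fun q => charInv_eq_smul_translate χ (D.toIdele u) q),
    ThetaKernelDatum.thetaLift_smul, ContinuousMap.smul_apply, smul_eq_mul, coe_chiFin_apply]

/-- **`U(W)`-`χ`-VARIANCE of the distribution**: `dist (charInv χ) (ωf (1, u) Φ_f) = χ(toIdele u)⁻¹ • dist (charInv χ) Φ_f`. -/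
theorem dist_ωf_W (χ : PontryaginDual (↥(relNormOneIdeles (↥(maximalRealSubfield L)) L) ⧸
      relNormOneRat (↥(maximalRealSubfield L)) L)) (u : D.Uf) (Φf : FinSB (↥(maximalRealSubfield L)) (Fin 3)) :
    D.dist (charInv χ) (D.ωf (1, u) Φf) = ((D.chiFin χ u : ℂˣ) : ℂ) • D.dist (charInv χ) Φf := by
  funext g
  refine WeightForms.eq_of_forall_dual_eq (R := ℂ) fun ℓ => ?_
  rw [Pi.smul_apply, map_smul, apply_dist, apply_dist, ThetaKernelDatum.thetaLiftFun_apply, ThetaKernelDatum.thetaLiftFun_apply,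
    smul_eq_mul]
  exact D.thetaLift_fam_ωf_W χ u Φf ℓ _

end ThetaDistDatum

end ThetaAdelicSide
end Model
end HodgeCM

end
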